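import Literature.Computability.QuantumComplexity.PathModelGadgetSector
import HarnessLib

/-!
# Words in the two-qubit gadgets: the `2 × 2` bookkeeping over `K5`

Topic `Literature/Computability/QuantumComplexity`; sequel of `PathModelGadgetSector.lean`. The
four gadget symbols `M, M⁻¹, M', M'⁻¹` (pure eight-strand braids, Aharonov–Arad 2011 §3.2 style
two-qubit gates at `k = 5`) act as the identity on `|enc 00⟩, |enc 01⟩, |enc 10⟩` and inside
`span{|enc 11⟩, ℓ'}` by explicit matrices `π(s) ∈ K5^{2×2}`. Hence a time-ordered WORD `g` in
the symbols acts on `|enc 11⟩` as `p(g) |enc 11⟩ + q(g) ℓ'` where `(p, q) = piVec g ∈ K5²` is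
computed by `2 × 2` matrix arithmetic in `K5` — exactly what the reduction machine does — and as
the identity on the other three code words:

* `Gadget.Sym`, `Sym.word`, `Sym.pi11 … pi22`, `expand`, `piVec`;
* `op_expand_enc11 : op (expand g) |enc 11⟩ = p(g) • |enc 11⟩ + q(g) • ℓ'`,
  `op_expand_enc2 : op (expand g) |enc b₁b₂⟩ = |enc b₁b₂⟩` for `(b₁,b₂) ≠ (1,1)`.

## References

* D. Aharonov, I. Arad, New J. Phys. 13 (2011) 035019; arXiv:quant-ph/0605181, §3.2
  [AharonovArad2011].
-/

noncomputable section

open Matrix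

namespace Literature.Computability.QuantumComplexity

open Cryptography QuadraticAlgebra

namespace Gadget

/-- The four gadget symbols. [cite: AharonovArad2011, §3.2] -/
inductive Sym
  | M | Minv | M' | M'inv
  deriving DecidableEq, Repr

namespace Sym

/-- The braid word of a symbol. [cite: AharonovArad2011, §3.2] -/
def word : Sym → List (Fin (2 * 4 - 1) × Bool)
  | M => wordM
  | Minv => wordMinv
  | M' => wordM'
  | M'inv => wordM'inv

/-- `π(s)₁₁` (coefficient of `|enc 11⟩` in `s |enc 11⟩`). [cite: AharonovArad2011, §3.2] -/
def pi11 : Sym → K5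
  | M => mtau2
  | Minv => mtau2
  | M' => mtau2
  | M'inv => mtau2

/-- `π(s)₂₁` (coefficient of `ℓ'` in `s |enc 11⟩`). [cite: AharonovArad2011, §3.2] -/
def pi21 : Sym → K5
  | M => 1
  | Minv => mzeta
  | M' => mzeta
  | M'inv => zeta2

/-- `π(s)₁₂` (coefficient of `|enc 11⟩` in `s ℓ'`). [cite: AharonovArad2011, §3.2] -/
def pi12 : Sym → K5
  | M => alpha
  | Minv => mzalpha
  | M' => alpha'
  | M'inv => alpha

/-- `π(s)₂₂` (coefficient of `ℓ'` in `s ℓ'`). [cite: AharonovArad2011, §3.2] -/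
def pi22 : Sym → K5
  | M => beta
  | Minv => mtau2zeta
  | M' => beta
  | M'inv => mtau2zeta

/-- One step of the bookkeeping: `(p, q) ↦ π(s) (p, q)`. [cite: AharonovArad2011, §3.2] -/
def step (s : Sym) (pq : K5 × K5) : K5 × K5 :=
  (s.pi11 * pq.1 + s.pi12 * pq.2, s.pi21 * pq.1 + s.pi22 * pq.2)

/-- **`s |enc 11⟩ = π₁₁ |enc 11⟩ + π₂₁ ℓ'`.** [cite: AharonovArad2011, §3.2] -/
theorem op_word_enc11 (s : Sym) :
    op s.word *ᵥ basisState (enc2 true true) =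
      K5.toComplex s.pi11 • basisState (enc2 true true) + K5.toComplex s.pi21 • leak := by
  cases s
  · rw [word, pi11, pi21, opM_enc11, map_one, one_smul]
  · exact opMinv_enc11
  · exact opM'_enc11
  · exact opM'inv_enc11

/-- **`s ℓ' = π₁₂ |enc 11⟩ + π₂₂ ℓ'`.** [cite: AharonovArad2011, §3.2] -/
theorem op_word_leak (s : Sym) :
    op s.word *ᵥ leak = K5.toComplex s.pi12 • basisState (enc2 true true) + K5.toComplex s.pi22 • leak := by
  cases s
  · exact opM_leak
  · exact opMinv_leak
  · exact opM'_leak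
  · exact opM'inv_leak

/-- **`s |enc b₁b₂⟩ = |enc b₁b₂⟩` for `(b₁, b₂) ≠ (1, 1)`.** [cite: AharonovArad2011, §3.2] -/
theorem op_word_enc2 (s : Sym) :
    ∀ {b₁ b₂ : Bool}, ¬(b₁ = true ∧ b₂ = true) → op s.word *ᵥ basisState (enc2 b₁ b₂) = basisState (enc2 b₁ b₂)
  | false, false, _ => by
    cases s
    · exact opM_enc00
    · exact opMinv_enc00
    · exact opM'_enc00
    · exact opM'inv_enc00
  | false, true, _ => by
    cases s
    · exact opM_enc01
    · exact opMinv_enc01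
    · exact opM'_enc01
    · exact opM'inv_enc01
  | true, false, _ => by
    cases s
    · exact opM_enc10
    · exact opMinv_enc10
    · exact opM'_enc10
    · exact opM'inv_enc10
  | true, true, h => absurd ⟨rfl, rfl⟩ h

end Sym

/-- **The braid word of a gadget word** (time-ordered, first symbol first). [cite: AharonovArad2011, §3.2] -/
def expand (g : List Sym) : List (Fin (2 * 4 - 1) × Bool) := g.flatMap Sym.word

/-- **The bookkeeping vector** `(p(g), q(g))`: start from `(1, 0)` and apply `π(s)` for each symbol
in time order. [cite: AharonovArad2011, §3.2] -/
def piVec (g : List Sym) : K5 × K5 := g.foldl (fun pq s => s.step pq) (1, 0)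

/-- `expand (g ++ [s]) = expand g ++ s.word`. [folklore] -/
theorem expand_append_singleton (g : List Sym) (s : Sym) : expand (g ++ [s]) = expand g ++ s.word := by
  simp [expand]

/-- `piVec (g ++ [s]) = π(s) (piVec g)`. [folklore] -/
theorem piVec_append_singleton (g : List Sym) (s : Sym) : piVec (g ++ [s]) = s.step (piVec g) := by
  simp [piVec]

/-- The operator of a concatenation: later letters act after. [folklore] -/
theorem op_append (u v : List (Fin (2 * 4 - 1) × Bool)) : op (u ++ v) = op v * op u := by
  rw [op, op, op, List.reverse_append, List.map_append, List.prod_append]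

/-- **A gadget word on `|enc 11⟩`**: `op (expand g) |enc 11⟩ = p(g) • |enc 11⟩ + q(g) • ℓ'`.
[cite: AharonovArad2011, §3.2] -/
theorem op_expand_enc11 (g : List Sym) :
    op (expand g) *ᵥ basisState (enc2 true true) =
      K5.toComplex (piVec g).1 • basisState (enc2 true true) + K5.toComplex (piVec g).2 • leak := by
  induction g using List.reverseRecOn with
  | nil => simp [expand, piVec, op]
  | append_singleton g s ih =>
    rw [expand_append_singleton, piVec_append_singleton, op_append, ← mulVec_mulVec, ih, mulVec_add,
      mulVec_smul, mulVec_smul, Sym.op_word_enc11, Sym.op_word_leak, Sym.step]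
    simp only [map_add, map_mul, smul_add, smul_smul, add_smul, mul_comm (K5.toComplex (piVec g).1),
      mul_comm (K5.toComplex (piVec g).2)]
    abel

/-- **A gadget word on the other code words** is the identity. [cite: AharonovArad2011, §3.2] -/
theorem op_expand_enc2 (g : List Sym) {b₁ b₂ : Bool} (h : ¬(b₁ = true ∧ b₂ = true)) :
    op (expand g) *ᵥ basisState (enc2 b₁ b₂) = basisState (enc2 b₁ b₂) := by
  induction g using List.reverseRecOn with
  | nil => simp [expand, op]
  | append_singleton g s ih =>
    rw [expand_append_singleton, op_append, ← mulVec_mulVec, ih, Sym.op_word_enc2 s h]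

end Gadget

end Literature.Computability.QuantumComplexity

end
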